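import Summits.QuantumAdvantage.QuantumAdvantage.Theses.ArithStatLadder

/-!
# Route `ArithStatLadder`, item `MirrorAssembly` (stmt-QuantumAdvantage-15007)

The support (glue) item of route `QuantumAdvantage/ArithStatLadder` assembling the GRH-free deciding
shape M:

`UnitCubeCriterion → MirrorRankRare → UnitCubeMemBQP → MirrorHeurTransfer → AvgFaceBeyondPrior → QuantumAdvantage`.

Pure logic over the route's own decls; nothing number-theoretic is proved here beyond `3 ∤ h(−3)`
(`h(−3) = 1`, kernel-evaluated). Argument (Scholz 1932 mirror pair `(ℚ(√3d), ℚ(√−d))`;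
Bogdanov–Trevisan 2006 §2.3 for the heuristic-class plumbing, both consumed only through the
hypotheses): suppose the summit `QuantumAdvantage = ∃ L, L ∈ BQP ∧ L ∉ BPP` fails. Then every `BQP`
language is in `BPP`, in particular the unit-cube language `L_ε` of `UnitCubeMemBQP`. On each dyadic
block of fundamental `−d`, the set where `L_ε` disagrees with `IQ3 = {3 ∣ h(−d)}` lies inside
`{d : #Cl(ℚ(√3d))[3] ≠ 1}`: for `d ≠ 3` this is the two halves of `UnitCubeCriterion`, and at `d = 3`
both sides say "no" (`h(−3) = 1`, `3 ≠ 3` fails). So `MirrorRankRare` gives the `(1/6 + ε)`-agreement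
hypothesis of `MirrorHeurTransfer` for `T = L_ε`, whence `¬ AvgFaceBeyondPrior` — contradiction.
Same argument as `quantumAdvantage_of_crux` in
`Cruxes/AvgFaceBeyondPrior/Lines/mirror_unit_signature.lean`, re-typed against the route literals
(no filter term is re-elaborated here: the disagreement filter is obtained by unification from
`MirrorHeurTransfer`, and `Finset.mem_filter` is used with its `DecidablePred` argument taken by
unification `(_)`, so no `Decidable`-instance drift between this file and the route file can occur).
-/

set_option linter.dupNamespace false -- D-0017: single-problem summit ⇒ `QuantumAdvantage.QuantumAdvantage` by design

namespace Summit.QuantumAdvantage.QuantumAdvantage.Theorems.ArithStatLadder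

open scoped Classical
open Summit.QuantumAdvantage.QuantumAdvantage.Theses.ArithStatLadder

/-- Settles `stmt-QuantumAdvantage-15007` (route ArithStatLadder, support `MirrorAssembly`):
`UnitCubeCriterion → MirrorRankRare → UnitCubeMemBQP → MirrorHeurTransfer → AvgFaceBeyondPrior →
QuantumAdvantage`. By contradiction: if no `BQP` language leaves `BPP`, the unit-cube language
`L_ε ∈ BQP` (`UnitCubeMemBQP`) is in `BPP`; by `UnitCubeCriterion` (and `h(−3) = 1` at the
degenerate point `d = 3`) its disagreement set with `IQ3` inside every block is contained in
`{d : #Cl(ℚ(√3d))[3] ≠ 1}`, which `MirrorRankRare` bounds by `(1/6 + ε)·#block` eventually; then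
`MirrorHeurTransfer` yields `¬ AvgFaceBeyondPrior`, contradicting the last hypothesis.
[cite: Scholz1932] [cite: BogdanovTrevisan2006, §2.3] -/
theorem MirrorAssembly_proof :
    Summit.QuantumAdvantage.QuantumAdvantage.Theses.ArithStatLadder.MirrorAssembly := by
  unfold Summit.QuantumAdvantage.QuantumAdvantage.Theses.ArithStatLadder.MirrorAssembly
    Summit.QuantumAdvantage.QuantumAdvantage.Theses.ArithStatLadder.UnitCubeCriterion
    Summit.QuantumAdvantage.QuantumAdvantage.Theses.ArithStatLadder.MirrorRankRare
    Summit.QuantumAdvantage.QuantumAdvantage.Theses.ArithStatLadder.UnitCubeMemBQP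
    Summit.QuantumAdvantage.QuantumAdvantage.Theses.ArithStatLadder.MirrorHeurTransfer
  intro h₁ h₂ h₃ h₄ h₅
  by_contra hno
  -- if the summit fails, every `BQP` language is in `BPP`
  have hall : ∀ L : Language Bool, L ∈ Literature.Computability.Cryptography.BQP →
      L ∈ Literature.Computability.Complexity.BPP :=
    fun L hL => by_contra fun hB => hno ⟨L, hL, hB⟩
  -- in particular the unit-cube language `L_ε`; feed it to the mirror transfer
  refine h₄ _ ?_ (hall _ h₃) h₅
  intro ε hε
  filter_upwards [h₂ ε hε] with n hn
  refine le_trans ?_ hn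
  refine Nat.cast_le.mpr (Finset.card_le_card fun d hd => ?_)
  -- membership in the two filters and in the block (`hf`: `−d` is fundamental), WITHOUT
  -- re-synthesising their (classical) decidability instances: `(_)` takes each instance by
  -- unification from the route's own terms
  have hd' := (@Finset.mem_filter _ _ (_) _ _).1 hd
  have hf := ((@Finset.mem_filter _ _ (_) _ _).1 hd'.1).2
  refine (@Finset.mem_filter _ _ (_) _ _).2 ⟨hd'.1, fun ht => hd'.2 ?_⟩
  by_cases h3 : d = 3
  · -- degenerate point: `h(−3) = 1`, and `3 ∉ L_ε` by definition
    subst h3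
    exact iff_of_false (by decide) fun hm => hm.2.1 rfl
  · have hc := h₁ d hf h3
    exact ⟨fun hdiv => ⟨hf, h3, hc.2 ht hdiv⟩, fun hm => hc.1 hm.2.2⟩

end Summit.QuantumAdvantage.QuantumAdvantage.Theorems.ArithStatLadder
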